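import Summits.CriticalPhenomena.PercolationContinuityZ3.Theorems.PercNearOneGluingNoHeavyPcintSiteBondWeights
import HarnessLib

/-!
# PCINT lane: Hammersley's site-versus-bond comparison, step 1b — the bond-cluster exploration dominates `π_p` step-wise

Cell `prim-pcint`, seat `prim-pcint-2` (gen 16).  Continues …PcintSiteBondWeights (product weights `ProdWt.pwt`, the bond weight
`SiteBond.bondWt` and the bond oracle `SiteBond.bondOut` run along `ClusterExpl.rule`).  Here the domination hypothesis `hdom` of
`AdaptDom.expect_le_of_dominating` is proved for process 2 = bond percolation on the finite vertex set `Λ`: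

* `SiteBond.bondOut_mix_replay`, `SiteBond.run_eq_iff_run_mix_eq` — the fibre `{run_n = σ}` does not read the edges from the
  selected site of `σ` to its unrevealed neighbours (every edge read before step `n` has both endpoints revealed in `σ`;
  `AdaptDom.run_eq_iff_replay`);
* `SiteBond.sum_bondWt_comp_eq_sum_wt` — the values reported at such a step are i.i.d. Bernoulli(`p`): their law IS `π_p` on the
  examined sites (the examined edges are edges of `G`, pairwise distinct);
* **`SiteBond.dominating`** — `AdaptDom.Dominating p (ClusterExpl.rule (bx G Λ) enc o) (bondWt G Λ p) (bondOut G Λ enc)`, with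
  EQUALITY at every non-root step (independence of the fibre indicator and the fresh edges under the product weight,
  `ProdWt.sum_pwt_mul_mul_of_indep`).

Step 2 (…PcintSiteBondBox) turns the final state into an open bond path and both sides into `P^site`/`P^bond` probabilities of
box events; step 3 (…PcintSiteBondComparison) passes to the limit `Λ = B(o, n) ↑`.
-/

namespace Summit.CriticalPhenomena.PercolationContinuityZ3.Theorems.Pcint

namespace SiteBond

open Finset AdaptDom ClusterExpl ProdWt

variable {V : Type*} {G : SimpleGraph V} {Λ : Finset V} [DecidableEq V] [DecidableRel G.Adj] {enc : ↥Λ → ℕ}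

/-! ### The fibres of the run do not read the fresh edges -/

/-- Along a replay `run (readOut σ) n = σ`, the replayed states are below `σ`: a site revealed at step `k ≤ n` keeps its
value in `σ`. -/
theorem replay_apply_eq {o : ↥Λ} {σ : ↥Λ → Option Bool} {n : ℕ} (hrep : run (R G Λ enc o) (readOut σ) n = σ)
    {k : ℕ} (hk : k ≤ n) {v : ↥Λ} (hv : run (R G Λ enc o) (readOut σ) k v ≠ none) :
    σ v = run (R G Λ enc o) (readOut σ) k v := by
  have := run_apply_of_ne_none (rule_unrevealed (bx G Λ) enc o) (readOut σ) hv n hk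
  rw [hrep] at this
  exact this

/-- A site examined at a replay step `k < n` is revealed in `σ`. -/
theorem ne_none_of_mem_replay {o : ↥Λ} {σ : ↥Λ → Option Bool} {n : ℕ} (hrep : run (R G Λ enc o) (readOut σ) n = σ)
    {k : ℕ} (hk : k < n) {a : ↥Λ} (ha : a ∈ R G Λ enc o (run (R G Λ enc o) (readOut σ) k)) : σ a ≠ none := by
  have h1 := run_succ_apply_of_mem (R := R G Λ enc o) (readOut σ) k ha
  have h2 : run (R G Λ enc o) (readOut σ) (k + 1) a ≠ none := by rw [h1]; simp
  rw [replay_apply_eq hrep (Nat.succ_le_of_lt hk) h2]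
  exact h2

/-- **The fresh edges are not read by the fibre condition.**  Let `σ` be a non-initial state with selected site `b`,
`T` the set of coordinates `{b, v}`, `v` unrevealed in `σ`.  Then at every replayed state `σ_k` (`k < n`) of a replay
`run (readOut σ) n = σ` and every examined site `a`, the oracle's report does not change when the `T`-coordinates of the
edge configuration are replaced. -/
theorem bondOut_mix_replay {o : ↥Λ} {σ : ↥Λ → Option Bool} {n : ℕ} (hrep : run (R G Λ enc o) (readOut σ) n = σ)
    {b : ↥Λ} (T : Finset ↥(Λ.sym2))
    (hT : ∀ e ∈ T, ∃ v : ↥Λ, σ v = none ∧ e = ek b v) (w w' : ↥(Λ.sym2) → Bool)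
    {k : ℕ} (hk : k < n) {a : ↥Λ} (ha : a ∈ R G Λ enc o (run (R G Λ enc o) (readOut σ) k)) :
    bondOut G Λ enc (mix T w w') (run (R G Λ enc o) (readOut σ) k) a =
      bondOut G Λ enc w' (run (R G Λ enc o) (readOut σ) k) a := by
  set σk := run (R G Λ enc o) (readOut σ) k with hσk
  by_cases hinit : ∀ u, σk u = none
  · rw [bondOut_of_init hinit, bondOut_of_init hinit]
  · cases hselk : sel (bx G Λ) enc σk with
    | none => rw [bondOut_of_sel_none hinit hselk, bondOut_of_sel_none hinit hselk]
    | some b' =>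
      rw [bondOut_of_sel_some hinit hselk, bondOut_of_sel_some hinit hselk]
      -- the edge `{b', a}` is not fresh: both endpoints are revealed in `σ`
      have ha' : σ a ≠ none := ne_none_of_mem_replay hrep hk ha
      have h1 : σk b' = some true := eq_some_true_of_sel hselk
      have h1' : run (R G Λ enc o) (readOut σ) k b' ≠ none := by rw [← hσk, h1]; simp
      have hb' : σ b' ≠ none := by rw [replay_apply_eq hrep hk.le h1']; exact h1'
      unfold mix
      rw [if_neg]
      intro hmem
      obtain ⟨v, hv, he⟩ := hT _ hmem
      rcases ek_eq_ek_iff.1 he with ⟨-, rfl⟩ | ⟨rfl, -⟩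
      · exact ha' hv
      · exact hb' hv

/-- **The fibre `{run_n = σ}` is blind to the fresh edges**: membership is unchanged when the `T`-coordinates are replaced. -/
theorem run_eq_iff_run_mix_eq {o : ↥Λ} {σ : ↥Λ → Option Bool} {n : ℕ} {b : ↥Λ}
    (T : Finset ↥(Λ.sym2)) (hT : ∀ e ∈ T, ∃ v : ↥Λ, σ v = none ∧ e = ek b v) (w w' : ↥(Λ.sym2) → Bool) :
    run (R G Λ enc o) (bondOut G Λ enc (mix T w w')) n = σ ↔ run (R G Λ enc o) (bondOut G Λ enc w') n = σ := by
  rw [run_eq_iff_replay (rule_unrevealed (bx G Λ) enc o) (bondOut G Λ enc (mix T w w')) n σ,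
    run_eq_iff_replay (rule_unrevealed (bx G Λ) enc o) (bondOut G Λ enc w') n σ]
  refine and_congr_right fun hrep => forall_congr' fun k => forall_congr' fun hk => forall_congr' fun a =>
    forall_congr' fun ha => ?_
  rw [bondOut_mix_replay hrep T hT w w' hk ha]

/-! ### The reported values at a non-root step are i.i.d. Bernoulli(`p`) -/

omit [DecidableRel G.Adj] in
/-- **The law of the reported pattern is `π_p` on the examined sites**: for a step test function `g` of `S` (monotone in,
and reading only, the `S`-coordinates), if every `v ∈ S` is a `G`-neighbour of `b`, then
`E_{bondWt}[g(pattern)] = E_{π_p}[g]`. -/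
theorem sum_bondWt_comp_eq_sum_wt (p : ℝ) {b : ↥Λ} {S : Finset ↥Λ} (hS : ∀ v ∈ S, G.Adj b.1 v.1)
    (g : (↥Λ → Bool) → ℝ) (hg : StepTest S g) :
    ∑ w : ↥(Λ.sym2) → Bool, bondWt G Λ p w * g (pat b S w) = ∑ ω : ↥Λ → Bool, wt p ω * g ω := by
  classical
  set T : Finset ↥(Λ.sym2) := S.image (ek b) with hTdef
  have hf : ∀ e : ↥(Λ.sym2), ef G p e.1 true + ef G p e.1 false = 1 := fun e => ef_true_add_ef_false G p e.1
  -- both sides as sums over outcome patterns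
  have hblindE : ∀ w : ↥(Λ.sym2) → Bool, g (pat b S w) = g (pat b S (mix T w fun _ => false)) := by
    intro w
    refine hg.2 _ _ fun v hv => ?_
    have hmem : ek b v ∈ T := mem_image_of_mem _ hv
    simp only [pat, if_pos hv, mix, if_pos hmem]
  have hblindΛ : ∀ ω : ↥Λ → Bool, g ω = g (mix S ω fun _ => false) :=
    fun ω => hg.2 _ _ fun v hv => by simp [mix, hv]
  unfold bondWt
  rw [sum_pwt_mul_eq_sum_slice hf T (fun _ => false) (fun w => g (pat b S w)) hblindE,
    sum_wt_mul_eq_sum_slice p S (fun _ => false) g hblindΛ]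
  -- bijection `slice T 0 ≃ slice S 0`: `x ↦ pat b S x`, inverse `unpat b S`
  refine Finset.sum_nbij' (pat b S) (unpat b S) (fun x hx => ?_) (fun y hy => ?_) (fun x hx => ?_) (fun y hy => ?_)
    (fun x hx => ?_)
  · -- `pat` lands in the slice
    exact mem_filter.2 ⟨mem_univ _, fun v hv => by simp [pat, hv]⟩
  · -- `unpat` lands in the slice
    refine mem_filter.2 ⟨mem_univ _, fun e he => ?_⟩
    unfold unpat
    rw [dif_neg]
    rintro ⟨v, hv, rfl⟩
    exact he (mem_image_of_mem _ hv)
  · -- left inverse on the slice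
    have hx' : ∀ e, e ∉ T → x e = false := (mem_filter.1 hx).2
    funext e
    unfold unpat
    by_cases h : ∃ v ∈ S, ek b v = e
    · rw [dif_pos h]
      obtain ⟨v, hv, hve⟩ := id h
      subst hve
      rw [choose_ek_eq h]
      simp [pat, hv]
    · rw [dif_neg h, hx' e]
      intro he
      obtain ⟨v, hv, hve⟩ := mem_image.1 he
      exact h ⟨v, hv, hve⟩
  · -- right inverse on the slice
    have hy' : ∀ v, v ∉ S → y v = false := (mem_filter.1 hy).2
    funext v
    unfold pat
    by_cases hv : v ∈ S
    · rw [if_pos hv]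
      unfold unpat
      have h : ∃ v' ∈ S, ek b v' = ek b v := ⟨v, hv, rfl⟩
      rw [dif_pos h, choose_ek_eq h]
    · rw [if_neg hv, hy' v hv]
  · -- equal summands: the weights agree (edges from `b` to its neighbours carry the Bernoulli weight)
    congr 1
    rw [hTdef, Finset.prod_image fun v _ v' _ h => ek_injective b h]
    refine Finset.prod_congr rfl fun v hv => ?_
    rw [ef_of_mem_edgeSet G p (by rw [ek_val, SimpleGraph.mem_edgeSet]; exact hS v hv)]
    simp [pat, hv]

/-! ### Step-wise domination -/

/-- **The bond exploration dominates `π_p` step-wise** (hypothesis `hdom` of `AdaptDom.expect_le_of_dominating`), for every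
finite vertex set `Λ`, ranking `enc`, root `o` and `p ∈ [0, 1]`.  At the root step the report `open` dominates; at a step
with no selected site nothing is examined; at a step from the selected site `b`, the fibre `{run_n = σ}` reads only edges
with both endpoints revealed while the reports read the fresh edges `{b, v}`, `v` unrevealed — independent under the
product weight, and i.i.d. Bernoulli(`p`) (equality holds). -/
theorem dominating {p : ℝ} (hp0 : 0 ≤ p) (hp1 : p ≤ 1) (o : ↥Λ) :
    Dominating p (R G Λ enc o) (bondWt G Λ p) (bondOut G Λ enc) := by
  classical
  intro n σ g hg
  set A := univ.filter (fun w : ↥(Λ.sym2) → Bool => run (R G Λ enc o) (bondOut G Λ enc w) n = σ) with hA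
  have hμ0 : ∀ w, 0 ≤ bondWt G Λ p w := bondWt_nonneg G Λ hp0 hp1
  have hAnn : 0 ≤ ∑ w ∈ A, bondWt G Λ p w := Finset.sum_nonneg fun w _ => hμ0 w
  by_cases hinit : ∀ u, σ u = none
  · -- root step: the report is identically `open`
    have hle : ∀ ω : ↥Λ → Bool, g ω ≤ g (fun _ => true) :=
      fun ω => hg.1 _ _ fun v _ => Bool.le_true (ω v)
    have hout : ∀ w, g (bondOut G Λ enc w σ) = g (fun _ => true) :=
      fun w => congrArg g (funext fun v => bondOut_of_init hinit w v)
    calc (∑ w ∈ A, bondWt G Λ p w) * ∑ ω : ↥Λ → Bool, wt p ω * g ω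
        ≤ (∑ w ∈ A, bondWt G Λ p w) * ∑ ω : ↥Λ → Bool, wt p ω * g (fun _ => true) :=
          mul_le_mul_of_nonneg_left (Finset.sum_le_sum fun ω _ =>
            mul_le_mul_of_nonneg_left (hle ω) (wt_nonneg hp0 hp1 ω)) hAnn
      _ = ∑ w ∈ A, bondWt G Λ p w * g (bondOut G Λ enc w σ) := by
          rw [← Finset.sum_mul, sum_wt, one_mul, Finset.sum_mul]
          exact Finset.sum_congr rfl fun w _ => by rw [hout w]
  · cases hsel : sel (bx G Λ) enc σ with
    | none =>
      -- nothing is examined: `g` is constant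
      have hR : R G Λ enc o σ = ∅ := rule_eq_empty_of_sel_eq_none (bx G Λ) enc o hinit hsel
      have hconst : ∀ x x' : ↥Λ → Bool, g x = g x' := fun x x' => hg.2 _ _ fun v hv => by
        rw [hR] at hv; simp at hv
      refine le_of_eq ?_
      calc (∑ w ∈ A, bondWt G Λ p w) * ∑ ω : ↥Λ → Bool, wt p ω * g ω
          = (∑ w ∈ A, bondWt G Λ p w) * ∑ ω : ↥Λ → Bool, wt p ω * g (fun _ => false) := by
            congr 1
            exact Finset.sum_congr rfl fun ω _ => by rw [hconst ω (fun _ => false)]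
        _ = ∑ w ∈ A, bondWt G Λ p w * g (bondOut G Λ enc w σ) := by
            rw [← Finset.sum_mul, sum_wt, one_mul, Finset.sum_mul]
            exact Finset.sum_congr rfl fun w _ => by rw [hconst (bondOut G Λ enc w σ) (fun _ => false)]
    | some b =>
      -- the examined sites: unrevealed neighbours of `b`; the fresh edges `T`
      set S := R G Λ enc o σ with hSdef
      have hS : ∀ v ∈ S, G.Adj b.1 v.1 ∧ σ v = none := by
        intro v hv
        have : v ∈ rule (bx G Λ) enc o σ := hv
        unfold rule at this
        rw [if_neg hinit, hsel] at this
        exact (mem_filter.1 this).2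
      set T : Finset ↥(Λ.sym2) := S.image (ek b) with hTdef
      have hT : ∀ e ∈ T, ∃ v : ↥Λ, σ v = none ∧ e = ek b v := by
        intro e he
        obtain ⟨v, hv, rfl⟩ := mem_image.1 he
        exact ⟨v, (hS v hv).2, rfl⟩
      -- the report as a pattern
      have hout : ∀ w, g (bondOut G Λ enc w σ) = g (pat b S w) := by
        intro w
        refine hg.2 _ _ fun v hv => ?_
        rw [bondOut_of_sel_some hinit hsel]; simp [pat, hv]
      -- independence of the fibre indicator (blind to `T`) and the pattern (reads only `T`)
      let ind : (↥(Λ.sym2) → Bool) → ℝ := fun w => if run (R G Λ enc o) (bondOut G Λ enc w) n = σ then 1 else 0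
      have h₁ : ∀ a a', ind (mix T a a') = ind a' := by
        intro a a'
        simp only [ind, run_eq_iff_run_mix_eq T hT a a']
      have h₂ : ∀ a a', g (pat b S (mix T a a')) = g (pat b S a) := by
        intro a a'
        refine hg.2 _ _ fun v hv => ?_
        have hmem : ek b v ∈ T := mem_image_of_mem _ hv
        simp only [pat, if_pos hv, mix, if_pos hmem]
      have hf : ∀ e : ↥(Λ.sym2), ef G p e.1 true + ef G p e.1 false = 1 := fun e => ef_true_add_ef_false G p e.1
      have hind := sum_pwt_mul_mul_of_indep hf T ind (fun w => g (pat b S w)) h₁ h₂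
      -- rewrite the filtered sums as indicator sums
      have hfilt : ∀ h : (↥(Λ.sym2) → Bool) → ℝ,
          ∑ w ∈ A, bondWt G Λ p w * h w = ∑ w, pwt (fun e : ↥(Λ.sym2) => ef G p e.1) w * (ind w * h w) := by
        intro h
        rw [hA, Finset.sum_filter]
        refine Finset.sum_congr rfl fun w _ => ?_
        by_cases hw : run (R G Λ enc o) (bondOut G Λ enc w) n = σ
        · simp only [if_pos hw, ind, one_mul]
        · simp only [if_neg hw, ind, zero_mul, mul_zero]
      have hsumA : ∑ w ∈ A, bondWt G Λ p w = ∑ w, pwt (fun e : ↥(Λ.sym2) => ef G p e.1) w * ind w := by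
        have := hfilt fun _ => 1
        simp only [mul_one] at this
        exact this
      have htrans := sum_bondWt_comp_eq_sum_wt (G := G) (Λ := Λ) p (fun v hv => (hS v hv).1) g hg
      refine le_of_eq ?_
      calc (∑ w ∈ A, bondWt G Λ p w) * ∑ ω : ↥Λ → Bool, wt p ω * g ω
          = (∑ w, pwt (fun e : ↥(Λ.sym2) => ef G p e.1) w * ind w) *
              ∑ w, pwt (fun e : ↥(Λ.sym2) => ef G p e.1) w * g (pat b S w) := by
            rw [hsumA, ← htrans]
        _ = ∑ w, pwt (fun e : ↥(Λ.sym2) => ef G p e.1) w * (ind w * g (pat b S w)) := hind.symm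
        _ = ∑ w ∈ A, bondWt G Λ p w * g (bondOut G Λ enc w σ) := by
            rw [hfilt]
            exact Finset.sum_congr rfl fun w _ => by rw [hout w]

end SiteBond

end Summit.CriticalPhenomena.PercolationContinuityZ3.Theorems.Pcint
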